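import Literature.NumberTheory.Sieve.PowTwoCosSumMoments
import Literature.NumberTheory.Sieve.GoldbachLinnikParseval
import Mathlib.Analysis.SpecialFunctions.Trigonometric.Series
import Mathlib.Data.Nat.Choose.Central
import HarnessLib

/-!
# Large deviations of `|G_L|`, `G_L(x) = ∑_{j<L} e(2^j x)`: Pintz–Ruzsa I, Lemma 4 and the set `𝓔`

Topic `Literature/NumberTheory/Sieve`; sequel to `PowTwoCosSumMoments.lean` (the exponential moments
`E_L(ξ) = ∫₀¹ e^{ξ S_L}` of `S_L = Re G_L` and Theorem 2(b)), in the vocabulary of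
`GoldbachLinnikParseval.lean` for the last statement (`GoldbachLinnik.powSum N α = ∑_{m=1}^{L} e(2^m α)`,
`L = GoldbachLinnik.powLen N`). Everything here is PROVED; no named fact, no numerics.

J. Pintz, I. Z. Ruzsa, *On Linnik's approximation to Goldbach's problem, I*, Acta Arith. 109 (2003),
§4, Lemma 4 and (4.13): `∫₀¹ e^{ξ|G_L(x)|} dx ≤ c(1 + √L) ∫₀¹ e^{ξ S_L(x)} dx` for `ξ ≥ 0`, whence
(§7, Corollaries 1–2) the measure of `𝓔 = {x : |G_L(x)| > (1-η)L}` is exponentially small in `L` as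
soon as `ξ(1-η) > ψ(ξ)`. This file proves Lemma 4 for `G = G_L` with crude (polynomial-in-`L`)
constants, following the printed proof:

* `powTwoExpSum` (`G_L`), `powTwoExpSum_re` (`Re G_L = S_L`), `powTwoExpSum_add_conj`
  (`G_L + conj G_L = 2 S_L`), `powTwoExpSum_pow` (the frequencies of `G_L^a`), `coincCount` and
  `integral_pow_mul_conj_pow`: `∫₀¹ G_L^a conj(G_L)^b = N(a,b) ∈ ℕ` (orthogonality);
* `integral_two_mul_cosSum_pow` (binomial expansion of `∫ (2S_L)ⁿ`), `integral_cosSum_pow_nonneg`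
  ("`∫₀¹ S(x)ʲ dx ≥ 0` for every `j`"), `integral_norm_powTwoExpSum_pow` (`∫ |G_L|^{2j} = N(j,j)`),
  `centralBinom_mul_integral_norm_pow_le` and `integral_norm_pow_le` ((4.16):
  `∫ |G_L|^{2j} ≤ (2j+1) ∫ S_L^{2j}`, through `4ʲ ≤ 2j·C(2j,j)` instead of `c√(j+1)`);
* `sum_integral_cosSum_pow_le_expMoment` (`∑_{i<I} ξⁱ/i! ∫ S_Lⁱ ≤ E_L(ξ)`, dominated convergence and
  monotonicity), `cosh_le_sum_add` (truncated `cosh` series), and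
  **`integral_exp_norm_powTwoExpSum_le`**: `∫₀¹ e^{ξ|G_L|} ≤ 4K E_L(ξ) + 8/3`, `K = ⌈(ξL)²⌉ + 1` ((4.17));
* Chernoff: `measureReal_norm_powTwoExpSum_ge_le` (`|{x ∈ [0,1] : |G_L(x)| ≥ t}| ≤ e^{-ξt}(4K E_L(ξ) + 8/3)`),
  `powSum_eq_powTwoExpSum` (`G(α) = G_L(2α)`), `measureReal_norm_powTwoExpSum_two_mul_ge_le`
  (doubling the variable, period `1`) and `measureReal_norm_powSum_ge_le` — the same bound for the
  tree's `G = GoldbachLinnik.powSum`, i.e. for the set `𝓔` of (10.6);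
* `measureReal_norm_powSum_ge_le_of_discMoment_le` — "Corollary 2 modulo one number": given ANY certified
  bound `E*_M(ξ) ≤ B` (`B ≥ 1`), `|{α : |G(α)| ≥ t}| ≤ e^{-ξt}(4K e^{ξM} e^{L (log B)/M} + 8/3)`.

Combined with `expMoment_le_pow_mul_exp` (`E_L ≤ E*_M(ξ)^{⌊L/M⌋} e^{ξ(L mod M)}`), the ONLY missing
input for a Corollary-2-type statement `|𝓔| ≤ C L² N^{-c}` with explicit `λ, c` is a numerical upper
bound for one finite sum `E*_M(ξ)` (Pintz–Ruzsa: `λ = 0.7894…` at `c = 3/5` by the refined method of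
§§5–6); none is asserted here.

## References

* J. Pintz, I. Z. Ruzsa, *On Linnik's approximation to Goldbach's problem, I*, Acta Arith. 109
  (2003) 169–194, §4 Lemma 4 with (4.13)–(4.17), §7 Corollaries 1–2, §8 (8.4), §10 (10.6). [PintzRuzsa2003]
-/

noncomputable section

open scoped FourierTransform

open Finset Filter MeasureTheory Real
open scoped Topology

namespace Literature.NumberTheory.Sieve

namespace PintzRuzsa2003

open GoldbachLinnik

/-! ### The generating function `G_L` of the powers of `2` -/

/-- `G_L(x) = ∑_{j=0}^{L-1} e(2^j x)` (Pintz–Ruzsa I §4, `g = 2`); `S_L = Re G_L`.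
[cite: PintzRuzsa2003, §4 (definition of G_L)] -/
def powTwoExpSum (L : ℕ) (x : ℝ) : ℂ := ∑ j ∈ Finset.range L, (𝐞 (((2 ^ j : ℕ) : ℝ) * x) : ℂ)

/-- `Re e(t) = cos(2π t)`. [folklore] -/
theorem fourierChar_coe_re (t : ℝ) : ((𝐞 t : ℂ)).re = Real.cos (2 * π * t) := by
  rw [Real.fourierChar_apply, Complex.exp_ofReal_mul_I_re]

/-- `Re G_L = S_L`. [cite: PintzRuzsa2003, §4 (S_L = Re G_L)] -/
theorem powTwoExpSum_re (L : ℕ) (x : ℝ) : (powTwoExpSum L x).re = cosSum L x := by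
  unfold powTwoExpSum cosSum
  rw [Complex.re_sum]
  refine Finset.sum_congr rfl fun j _ => ?_
  rw [fourierChar_coe_re]
  push_cast
  ring_nf

/-- `|G_L(x)| ≤ L`. [folklore] -/
theorem norm_powTwoExpSum_le (L : ℕ) (x : ℝ) : ‖powTwoExpSum L x‖ ≤ L := by
  unfold powTwoExpSum
  calc ‖∑ j ∈ Finset.range L, (𝐞 (((2 ^ j : ℕ) : ℝ) * x) : ℂ)‖
      ≤ ∑ j ∈ Finset.range L, ‖(𝐞 (((2 ^ j : ℕ) : ℝ) * x) : ℂ)‖ := norm_sum_le _ _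
    _ = L := by simp

/-- `G_L + conj G_L = 2 S_L`. [folklore] -/
theorem powTwoExpSum_add_conj (L : ℕ) (x : ℝ) :
    powTwoExpSum L x + (starRingEnd ℂ) (powTwoExpSum L x) = ((2 * cosSum L x : ℝ) : ℂ) := by
  rw [Complex.add_conj, powTwoExpSum_re]

/-- `G_L` is continuous. [folklore] -/
theorem continuous_powTwoExpSum (L : ℕ) : Continuous (powTwoExpSum L) := by
  unfold powTwoExpSum
  refine continuous_finsetSum _ fun j _ => ?_
  exact continuous_subtype_val.comp (Real.continuous_fourierChar.comp (continuous_const.mul continuous_id))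

/-! ### Powers of `G_L` and their frequencies -/

/-- The frequency `2^{ν₁} + ⋯ + 2^{ν_a}` of a tuple. [folklore] -/
def tupleFreq {a : ℕ} (f : Fin a → ℕ) : ℕ := ∑ i, 2 ^ f i

/-- `G_L(x)^a = ∑_{ν ∈ [0,L)^a} e((2^{ν₁} + ⋯ + 2^{ν_a}) x)`. [cite: PintzRuzsa2003, §4 (proof of Lemma 4, (4.16))] -/
theorem powTwoExpSum_pow (L a : ℕ) (x : ℝ) :
    powTwoExpSum L x ^ a =
      ∑ f ∈ Fintype.piFinset (fun _ : Fin a => Finset.range L), (𝐞 ((tupleFreq f : ℝ) * x) : ℂ) := by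
  rw [← Fin.prod_const a (powTwoExpSum L x)]
  simp only [powTwoExpSum]
  rw [Finset.prod_univ_sum]
  refine Finset.sum_congr rfl fun f _ => ?_
  rw [← fourierChar_sum_coe]
  congr 2
  unfold tupleFreq
  push_cast
  rw [Finset.sum_mul]

/-- Conjugating `e(t)` negates the frequency. [folklore] -/
theorem conj_fourierChar_coe (t : ℝ) : (starRingEnd ℂ) (𝐞 t : ℂ) = (𝐞 (-t) : ℂ) := by
  rw [← Circle.coe_inv_eq_conj, ← AddChar.map_neg_eq_inv]

/-- The coincidence count `N(a, b) = #{(ν, μ) ∈ [0,L)^a × [0,L)^b : ∑ 2^{νᵢ} = ∑ 2^{μⱼ}}`.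
[cite: PintzRuzsa2003, §4 (proof of Lemma 4)] -/
def coincCount (L a b : ℕ) : ℕ :=
  ((Fintype.piFinset (fun _ : Fin a => Finset.range L) ×ˢ Fintype.piFinset (fun _ : Fin b => Finset.range L)).filter
    fun z => tupleFreq z.1 = tupleFreq z.2).card

/-- **Orthogonality**: `∫₀¹ G_L^a · conj(G_L)^b = N(a, b)` — a nonnegative integer (the "positive
polynomial in the coefficients" of the proof of Lemma 4). [cite: PintzRuzsa2003, §4 (proof of Lemma 4)] -/
theorem integral_pow_mul_conj_pow (L a b : ℕ) :
    ∫ x in (0 : ℝ)..1, powTwoExpSum L x ^ a * (starRingEnd ℂ) (powTwoExpSum L x) ^ b = (coincCount L a b : ℂ) := by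
  have hconj : ∀ x, (starRingEnd ℂ) (powTwoExpSum L x) ^ b =
      ∑ g ∈ Fintype.piFinset (fun _ : Fin b => Finset.range L), (𝐞 (-((tupleFreq g : ℝ) * x)) : ℂ) := by
    intro x
    rw [← map_pow, powTwoExpSum_pow, map_sum]
    exact Finset.sum_congr rfl fun g _ => conj_fourierChar_coe _
  simp_rw [powTwoExpSum_pow, hconj, Finset.sum_mul_sum]
  have hterm : ∀ (f : Fin a → ℕ) (g : Fin b → ℕ) (x : ℝ),
      (𝐞 ((tupleFreq f : ℝ) * x) : ℂ) * (𝐞 (-((tupleFreq g : ℝ) * x)) : ℂ) =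
        (𝐞 ((((tupleFreq f : ℤ) - tupleFreq g : ℤ) : ℝ) * x) : ℂ) := by
    intro f g x
    rw [← fourierChar_add_coe]
    congr 2
    push_cast
    ring
  simp_rw [hterm]
  have hcont : ∀ k : ℤ, Continuous fun x : ℝ => (𝐞 ((k : ℝ) * x) : ℂ) := fun k =>
    continuous_subtype_val.comp (Real.continuous_fourierChar.comp (continuous_const.mul continuous_id))
  have horth : ∀ n : ℤ, ∫ x in (0 : ℝ)..1, (𝐞 (n * x) : ℂ) = if n = 0 then 1 else 0 :=
    integral_fourierChar_intCast_holds
  rw [intervalIntegral.integral_finsetSum fun f _ =>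
    (continuous_finsetSum _ fun g _ => hcont _).intervalIntegrable _ _]
  simp_rw [intervalIntegral.integral_finsetSum fun g _ => (hcont _).intervalIntegrable _ _]
  simp_rw [horth, sub_eq_zero, Nat.cast_inj]
  rw [coincCount, Finset.card_filter, Finset.sum_product]
  push_cast
  exact Finset.sum_congr rfl fun f _ => Finset.sum_congr rfl fun g _ => by split_ifs <;> simp

/-! ### Moments of `S_L` against moments of `|G_L|` ((4.16)) -/

/-- **Binomial expansion of the moments of `2S_L = G_L + conj G_L`**:
`∫₀¹ (2 S_L(x))ⁿ dx = ∑_{m ≤ n} C(n, m) N(m, n-m)` (as complex numbers). [cite: PintzRuzsa2003, §4 (proof of Lemma 4)] -/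
theorem integral_two_mul_cosSum_pow_complex (L n : ℕ) :
    ∫ x in (0 : ℝ)..1, (((2 * cosSum L x : ℝ) : ℂ)) ^ n =
      ∑ m ∈ Finset.range (n + 1), ((n.choose m : ℕ) : ℂ) * (coincCount L m (n - m) : ℂ) := by
  have hexp : ∀ x, (((2 * cosSum L x : ℝ) : ℂ)) ^ n =
      ∑ m ∈ Finset.range (n + 1), ((n.choose m : ℕ) : ℂ) *
        (powTwoExpSum L x ^ m * (starRingEnd ℂ) (powTwoExpSum L x) ^ (n - m)) := by
    intro x
    rw [← powTwoExpSum_add_conj, add_pow]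
    refine Finset.sum_congr rfl fun m _ => ?_
    ring
  simp_rw [hexp]
  have hcontG : Continuous (powTwoExpSum L) := continuous_powTwoExpSum L
  have hint : ∀ m ∈ Finset.range (n + 1), IntervalIntegrable (fun x => ((n.choose m : ℕ) : ℂ) *
      (powTwoExpSum L x ^ m * (starRingEnd ℂ) (powTwoExpSum L x) ^ (n - m))) volume 0 1 := by
    intro m _
    refine Continuous.intervalIntegrable ?_ _ _
    exact continuous_const.mul ((hcontG.pow m).mul ((Complex.continuous_conj.comp hcontG).pow _))
  rw [intervalIntegral.integral_finsetSum hint]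
  refine Finset.sum_congr rfl fun m _ => ?_
  rw [intervalIntegral.integral_const_mul, integral_pow_mul_conj_pow]

/-- The same, as real numbers: `∫₀¹ (2 S_L(x))ⁿ dx = ∑_{m ≤ n} C(n, m) N(m, n-m)`.
[cite: PintzRuzsa2003, §4 (proof of Lemma 4)] -/
theorem integral_two_mul_cosSum_pow (L n : ℕ) :
    ∫ x in (0 : ℝ)..1, (2 * cosSum L x) ^ n =
      ∑ m ∈ Finset.range (n + 1), ((n.choose m : ℕ) : ℝ) * (coincCount L m (n - m) : ℝ) := by
  apply Complex.ofReal_injective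
  rw [← intervalIntegral.integral_ofReal]
  push_cast
  have h := integral_two_mul_cosSum_pow_complex L n
  push_cast at h
  exact h

/-- **`∫₀¹ S_L(x)ʲ dx ≥ 0 for every j`** (Pintz–Ruzsa: "since `∫₀¹ S(x)ʲ dx ≥ 0` for every `j`").
[cite: PintzRuzsa2003, §4 (proof of Lemma 4, after (4.17))] -/
theorem integral_cosSum_pow_nonneg (L n : ℕ) : 0 ≤ ∫ x in (0 : ℝ)..1, cosSum L x ^ n := by
  have h := integral_two_mul_cosSum_pow L n
  have hsum : 0 ≤ ∑ m ∈ Finset.range (n + 1), ((n.choose m : ℕ) : ℝ) * (coincCount L m (n - m) : ℝ) :=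
    Finset.sum_nonneg fun m _ => by positivity
  have heq : ∫ x in (0 : ℝ)..1, (2 * cosSum L x) ^ n = 2 ^ n * ∫ x in (0 : ℝ)..1, cosSum L x ^ n := by
    rw [← intervalIntegral.integral_const_mul]
    refine intervalIntegral.integral_congr fun x _ => ?_
    rw [mul_pow]
  rw [heq] at h
  have h2 : (0 : ℝ) < 2 ^ n := by positivity
  nlinarith [h ▸ hsum]

/-- `∫₀¹ |G_L(x)|^{2j} dx = N(j, j)` (Parseval for `G_L^j`). [cite: PintzRuzsa2003, §4 (proof of Lemma 4, (4.15)–(4.16))] -/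
theorem integral_norm_powTwoExpSum_pow (L j : ℕ) :
    ∫ x in (0 : ℝ)..1, ‖powTwoExpSum L x‖ ^ (2 * j) = (coincCount L j j : ℝ) := by
  apply Complex.ofReal_injective
  rw [← intervalIntegral.integral_ofReal]
  have h := integral_pow_mul_conj_pow L j j
  rw [Complex.ofReal_natCast, ← h]
  refine intervalIntegral.integral_congr fun x _ => ?_
  rw [← map_pow, Complex.mul_conj, Complex.normSq_eq_norm_sq, norm_pow]
  push_cast
  ring

/-- **(4.16) for `G_L`**: `C(2j, j) ∫₀¹ |G_L|^{2j} ≤ 4ʲ ∫₀¹ S_L^{2j}` (keep the middle term of the binomial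
expansion). [cite: PintzRuzsa2003, §4 (4.16)] -/
theorem centralBinom_mul_integral_norm_pow_le (L j : ℕ) :
    (Nat.centralBinom j : ℝ) * ∫ x in (0 : ℝ)..1, ‖powTwoExpSum L x‖ ^ (2 * j) ≤
      4 ^ j * ∫ x in (0 : ℝ)..1, cosSum L x ^ (2 * j) := by
  rw [integral_norm_powTwoExpSum_pow]
  have h := integral_two_mul_cosSum_pow L (2 * j)
  have heq : ∫ x in (0 : ℝ)..1, (2 * cosSum L x) ^ (2 * j) = 4 ^ j * ∫ x in (0 : ℝ)..1, cosSum L x ^ (2 * j) := by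
    rw [← intervalIntegral.integral_const_mul]
    refine intervalIntegral.integral_congr fun x _ => ?_
    rw [mul_pow, pow_mul, show (2 : ℝ) ^ 2 = 4 by norm_num]
  rw [← heq, h]
  have hj : j ∈ Finset.range (2 * j + 1) := Finset.mem_range.mpr (by omega)
  rw [← Finset.add_sum_erase _ _ hj, Nat.centralBinom_eq_two_mul_choose, show 2 * j - j = j by omega]
  have hrest : 0 ≤ ∑ m ∈ (Finset.range (2 * j + 1)).erase j,
      (((2 * j).choose m : ℕ) : ℝ) * (coincCount L m (2 * j - m) : ℝ) :=
    Finset.sum_nonneg fun m _ => by positivity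
  linarith

/-- `∫₀¹ |G_L|^{2j} ≤ (2j + 1) ∫₀¹ S_L^{2j}` (`4ʲ ≤ 2j · C(2j, j)`; Pintz–Ruzsa have the sharper `c √(j+1)`).
[cite: PintzRuzsa2003, §4 (4.16)] -/
theorem integral_norm_pow_le (L j : ℕ) :
    ∫ x in (0 : ℝ)..1, ‖powTwoExpSum L x‖ ^ (2 * j) ≤ (2 * j + 1) * ∫ x in (0 : ℝ)..1, cosSum L x ^ (2 * j) := by
  have hS0 := integral_cosSum_pow_nonneg L (2 * j)
  rcases Nat.eq_zero_or_pos j with rfl | hj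
  · simp
  have hcb : (4 : ℝ) ^ j ≤ 2 * j * Nat.centralBinom j := by
    exact_mod_cast Nat.four_pow_le_two_mul_self_mul_centralBinom j hj
  have hcb0 : (0 : ℝ) < Nat.centralBinom j := by exact_mod_cast Nat.centralBinom_pos j
  have h := centralBinom_mul_integral_norm_pow_le L j
  have hG0 : 0 ≤ ∫ x in (0 : ℝ)..1, ‖powTwoExpSum L x‖ ^ (2 * j) :=
    intervalIntegral.integral_nonneg zero_le_one fun x _ => by positivity
  -- `cb · I_G ≤ 4^j I_S ≤ 2j cb I_S`
  have h2 : (Nat.centralBinom j : ℝ) * ∫ x in (0 : ℝ)..1, ‖powTwoExpSum L x‖ ^ (2 * j) ≤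
      (Nat.centralBinom j : ℝ) * ((2 * j) * ∫ x in (0 : ℝ)..1, cosSum L x ^ (2 * j)) := by
    calc _ ≤ 4 ^ j * ∫ x in (0 : ℝ)..1, cosSum L x ^ (2 * j) := h
      _ ≤ (2 * j * Nat.centralBinom j) * ∫ x in (0 : ℝ)..1, cosSum L x ^ (2 * j) :=
          mul_le_mul_of_nonneg_right hcb hS0
      _ = _ := by ring
  have h3 := le_of_mul_le_mul_left h2 hcb0
  nlinarith

/-! ### The even moments of `S_L` against `E_L(ξ)` -/

/-- `-L ≤ S_L(x)`, so `|S_L(x)| ≤ L`. [folklore] -/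
theorem abs_cosSum_le (L : ℕ) (x : ℝ) : |cosSum L x| ≤ L := by
  unfold cosSum
  calc |∑ j ∈ Finset.range L, Real.cos (2 * π * 2 ^ j * x)|
      ≤ ∑ j ∈ Finset.range L, |Real.cos (2 * π * 2 ^ j * x)| := Finset.abs_sum_le_sum_abs _ _
    _ ≤ ∑ j ∈ Finset.range L, (1 : ℝ) := Finset.sum_le_sum fun j _ => Real.abs_cos_le_one _
    _ = L := by simp

/-- Partial sums of the exponential series are bounded by `e^{|t|}`. [folklore] -/
theorem abs_sum_range_pow_div_factorial_le (t : ℝ) (I : ℕ) :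
    |∑ i ∈ Finset.range I, t ^ i / (Nat.factorial i)| ≤ Real.exp |t| := by
  have hsum : HasSum (fun i : ℕ => |t| ^ i / (Nat.factorial i)) (Real.exp |t|) := by
    rw [Real.exp_eq_exp_ℝ]
    exact NormedSpace.expSeries_div_hasSum_exp |t|
  calc |∑ i ∈ Finset.range I, t ^ i / (Nat.factorial i)|
      ≤ ∑ i ∈ Finset.range I, |t ^ i / (Nat.factorial i)| := Finset.abs_sum_le_sum_abs _ _
    _ = ∑ i ∈ Finset.range I, |t| ^ i / (Nat.factorial i) := by
        refine Finset.sum_congr rfl fun i _ => ?_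
        rw [abs_div, abs_pow, Nat.abs_cast]
    _ ≤ Real.exp |t| := sum_le_hasSum _ (fun i _ => by positivity) hsum

/-- **`∑_{i<I} ξⁱ/i! ∫₀¹ S_Lⁱ ≤ E_L(ξ)` for every `I`** (`ξ ≥ 0`): the partial sums are the integrals of the
partial sums of `e^{ξ S_L}`, which converge (dominatedly) to `E_L(ξ)`, and they increase with `I` because
every `∫ S_Lⁱ ≥ 0`. [cite: PintzRuzsa2003, §4 (proof of Lemma 4, after (4.17))] -/
theorem sum_integral_cosSum_pow_le_expMoment {ξ : ℝ} (hξ : 0 ≤ ξ) (L I : ℕ) :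
    ∑ i ∈ Finset.range I, ξ ^ i / (Nat.factorial i) * ∫ x in (0 : ℝ)..1, cosSum L x ^ i ≤ expMoment ξ L := by
  set a : ℕ → ℝ := fun I => ∑ i ∈ Finset.range I, ξ ^ i / (Nat.factorial i) * ∫ x in (0 : ℝ)..1, cosSum L x ^ i
    with ha
  -- the partial sums of `e^{ξ S_L}`
  have hTcont : ∀ I, Continuous fun x => ∑ i ∈ Finset.range I, (ξ * cosSum L x) ^ i / (Nat.factorial i : ℝ) :=
    fun I => continuous_finsetSum _ fun i _ => ((continuous_const.mul (continuous_cosSum L)).pow i).div_const _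
  have hIi : ∀ i : ℕ, IntervalIntegrable (fun x => (ξ * cosSum L x) ^ i / (Nat.factorial i : ℝ)) volume 0 1 :=
    fun i => (((continuous_const.mul (continuous_cosSum L)).pow i).div_const _).intervalIntegrable _ _
  have haT : ∀ I, a I = ∫ x in (0 : ℝ)..1, ∑ i ∈ Finset.range I, (ξ * cosSum L x) ^ i / (Nat.factorial i : ℝ) := by
    intro I
    rw [intervalIntegral.integral_finsetSum fun i _ => hIi i]
    refine Finset.sum_congr rfl fun i _ => ?_
    rw [← intervalIntegral.integral_const_mul]
    refine intervalIntegral.integral_congr fun x _ => ?_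
    rw [mul_pow]; ring
  -- dominated convergence
  have hlim : Tendsto a atTop (𝓝 (expMoment ξ L)) := by
    have e : a = fun I => ∫ x in (0 : ℝ)..1, ∑ i ∈ Finset.range I, (ξ * cosSum L x) ^ i / (Nat.factorial i : ℝ) :=
      funext haT
    rw [e]
    unfold expMoment
    refine intervalIntegral.tendsto_integral_filter_of_dominated_convergence (fun _ => Real.exp (ξ * L))
      (Eventually.of_forall fun I => (hTcont I).aestronglyMeasurable) ?_
      (continuous_const.intervalIntegrable _ _) ?_
    · refine Eventually.of_forall fun I => Eventually.of_forall fun x _ => ?_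
      rw [Real.norm_eq_abs]
      refine (abs_sum_range_pow_div_factorial_le _ _).trans (Real.exp_le_exp.mpr ?_)
      rw [abs_mul, abs_of_nonneg hξ]
      exact mul_le_mul_of_nonneg_left (abs_cosSum_le L x) hξ
    · exact Eventually.of_forall fun x _ => tendsto_sum_range_pow_div_factorial _
  -- monotonicity
  have hmono : Monotone a := by
    refine monotone_nat_of_le_succ fun I => ?_
    simp only [ha, Finset.sum_range_succ]
    have := integral_cosSum_pow_nonneg L I
    have : 0 ≤ ξ ^ I / (Nat.factorial I) * ∫ x in (0 : ℝ)..1, cosSum L x ^ I := by positivity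
    linarith
  exact hmono.ge_of_tendsto hlim I

/-- The even part: `∑_{j<K} ξ^{2j}/(2j)! ∫₀¹ S_L^{2j} ≤ E_L(ξ)` (`ξ ≥ 0`). [cite: PintzRuzsa2003, §4 (proof of Lemma 4)] -/
theorem sum_even_integral_cosSum_pow_le_expMoment {ξ : ℝ} (hξ : 0 ≤ ξ) (L K : ℕ) :
    ∑ j ∈ Finset.range K, ξ ^ (2 * j) / (Nat.factorial (2 * j)) * ∫ x in (0 : ℝ)..1, cosSum L x ^ (2 * j) ≤
      expMoment ξ L := by
  classical
  set g : ℕ → ℝ := fun i => ξ ^ i / (Nat.factorial i) * ∫ x in (0 : ℝ)..1, cosSum L x ^ i with hg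
  have hg0 : ∀ i, 0 ≤ g i := fun i => by
    simp only [hg]; have := integral_cosSum_pow_nonneg L i; positivity
  calc ∑ j ∈ Finset.range K, ξ ^ (2 * j) / (Nat.factorial (2 * j)) * ∫ x in (0 : ℝ)..1, cosSum L x ^ (2 * j)
      = ∑ i ∈ (Finset.range K).image (fun j => 2 * j), g i := by
        rw [Finset.sum_image fun a _ b _ h => by omega]
    _ ≤ ∑ i ∈ Finset.range (2 * K), g i := by
        refine Finset.sum_le_sum_of_subset_of_nonneg (fun i hi => ?_) fun i _ _ => hg0 i
        obtain ⟨j, hj, rfl⟩ := Finset.mem_image.mp hi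
        rw [Finset.mem_range] at hj ⊢; omega
    _ ≤ expMoment ξ L := sum_integral_cosSum_pow_le_expMoment hξ L (2 * K)

/-! ### `cosh` and its truncated series -/

/-- `y^{2K} ≤ (2K)!` when `y² ≤ K`. [folklore] -/
theorem pow_two_mul_le_factorial {y : ℝ} {K : ℕ} (hyK : y ^ 2 ≤ K) :
    y ^ (2 * K) ≤ (Nat.factorial (2 * K) : ℝ) := by
  have h1 : y ^ (2 * K) ≤ (K : ℝ) ^ K := by
    rw [pow_mul]; exact pow_le_pow_left₀ (by positivity) hyK K
  have h2 : (K : ℝ) ^ K ≤ (Nat.factorial (2 * K) : ℝ) := by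
    have h := Nat.factorial_mul_pow_le_factorial (m := K) (n := K)
    rw [← two_mul] at h
    have hK1 : (K : ℝ) ^ K ≤ ((K + 1 : ℕ) : ℝ) ^ K :=
      pow_le_pow_left₀ (Nat.cast_nonneg K) (by push_cast; linarith) K
    have hK2 : ((K + 1 : ℕ) : ℝ) ^ K ≤ (Nat.factorial K : ℝ) * ((K + 1 : ℕ) : ℝ) ^ K :=
      le_mul_of_one_le_left (by positivity) (by exact_mod_cast Nat.one_le_iff_ne_zero.mpr (Nat.factorial_ne_zero K))
    have hK3 : (Nat.factorial K : ℝ) * ((K + 1 : ℕ) : ℝ) ^ K ≤ (Nat.factorial (2 * K) : ℝ) := by exact_mod_cast h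
    exact hK1.trans (hK2.trans hK3)
  exact h1.trans h2

/-- **Truncated `cosh` series with a tail bound**: for `y² ≤ K`,
`cosh y ≤ ∑_{j<K} y^{2j}/(2j)! + 4/3` (the tail is dominated by the geometric series `∑ 4^{-j}`).
[cite: PintzRuzsa2003, §4 (proof of Lemma 4, the estimate of the second term of (4.17))] -/
theorem cosh_le_sum_add {y : ℝ} {K : ℕ} (hyK : y ^ 2 ≤ K) :
    Real.cosh y ≤ ∑ j ∈ Finset.range K, y ^ (2 * j) / (Nat.factorial (2 * j)) + 4 / 3 := by
  have hsum := Real.hasSum_cosh y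
  have hs : Summable fun n : ℕ => y ^ (2 * n) / (Nat.factorial (2 * n) : ℝ) := hsum.summable
  rw [← hsum.tsum_eq, ← hs.sum_add_tsum_nat_add K]
  gcongr
  -- tail: termwise `≤ (1/4)^j`
  have hgeo : HasSum (fun j : ℕ => (1 / 4 : ℝ) ^ j) (4 / 3) := by
    have h := hasSum_geometric_of_lt_one (r := (1 / 4 : ℝ)) (by norm_num) (by norm_num)
    norm_num at h ⊢
    exact h
  have hterm : ∀ j : ℕ, y ^ (2 * (j + K)) / (Nat.factorial (2 * (j + K)) : ℝ) ≤ (1 / 4 : ℝ) ^ j := by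
    intro j
    have hfac : (Nat.factorial (2 * K) : ℝ) * ((2 * K + 1 : ℕ) : ℝ) ^ (2 * j) ≤ (Nat.factorial (2 * (j + K)) : ℝ) := by
      have h := Nat.factorial_mul_pow_le_factorial (m := 2 * K) (n := 2 * j)
      rw [show 2 * K + 2 * j = 2 * (j + K) by ring] at h
      exact_mod_cast h
    have hfacpos : (0 : ℝ) < Nat.factorial (2 * (j + K)) := by positivity
    rw [div_le_iff₀ hfacpos]
    have hyK' : y ^ (2 * K) ≤ (Nat.factorial (2 * K) : ℝ) := pow_two_mul_le_factorial hyK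
    have h4 : 4 * y ^ 2 ≤ ((2 * K + 1 : ℕ) : ℝ) ^ 2 := by push_cast; nlinarith
    calc y ^ (2 * (j + K)) = y ^ (2 * K) * (y ^ 2) ^ j := by rw [← pow_mul, ← pow_add]; ring_nf
      _ ≤ (Nat.factorial (2 * K) : ℝ) * (((2 * K + 1 : ℕ) : ℝ) ^ 2 / 4) ^ j := by
          refine mul_le_mul hyK' (pow_le_pow_left₀ (by positivity) (by linarith) j) (by positivity) (by positivity)
      _ = (Nat.factorial (2 * K) : ℝ) * ((2 * K + 1 : ℕ) : ℝ) ^ (2 * j) / 4 ^ j := by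
          rw [div_pow, ← pow_mul]; ring
      _ = (1 / 4 : ℝ) ^ j * ((Nat.factorial (2 * K) : ℝ) * ((2 * K + 1 : ℕ) : ℝ) ^ (2 * j)) := by
          rw [one_div_pow]; ring
      _ ≤ (1 / 4 : ℝ) ^ j * (Nat.factorial (2 * (j + K)) : ℝ) := mul_le_mul_of_nonneg_left hfac (by positivity)
  have htail : Summable fun j : ℕ => y ^ (2 * (j + K)) / (Nat.factorial (2 * (j + K)) : ℝ) :=
    ((summable_nat_add_iff K).mpr hs).congr fun j => by ring_nf
  calc ∑' j : ℕ, y ^ (2 * (j + K)) / (Nat.factorial (2 * (j + K)) : ℝ) ≤ ∑' j : ℕ, (1 / 4 : ℝ) ^ j :=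
        Summable.tsum_le_tsum hterm htail hgeo.summable
    _ = 4 / 3 := hgeo.tsum_eq

/-! ### Lemma 4 for `G_L`: `∫ e^{ξ|G_L|}` against `E_L(ξ)` -/

/-- **Pintz–Ruzsa I, Lemma 4, for `G = G_L`** (crude constants): for `ξ ≥ 0`,
`∫₀¹ e^{ξ |G_L(x)|} dx ≤ 4K · E_L(ξ) + 8/3` with `K = ⌈(ξL)²⌉ + 1`
(`e^{t} ≤ 2 cosh t`, the truncated `cosh` series, (4.16) in the form `∫|G_L|^{2j} ≤ (2j+1)∫ S_L^{2j}`,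
and `∑_{j<K} ξ^{2j}/(2j)! ∫ S_L^{2j} ≤ E_L(ξ)`). Pintz–Ruzsa's constant is `c(1 + √L)`; polynomial losses
in `L` are irrelevant for (10.6). [cite: PintzRuzsa2003, §4 Lemma 4 (4.13)–(4.17)] -/
theorem integral_exp_norm_powTwoExpSum_le {ξ : ℝ} (hξ : 0 ≤ ξ) (L : ℕ) :
    ∫ x in (0 : ℝ)..1, Real.exp (ξ * ‖powTwoExpSum L x‖) ≤
      4 * ((⌈(ξ * L) ^ 2⌉₊ + 1 : ℕ) : ℝ) * expMoment ξ L + 8 / 3 := by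
  set K : ℕ := ⌈(ξ * L) ^ 2⌉₊ + 1 with hK
  have hYK : (ξ * L) ^ 2 ≤ K := by
    have := Nat.le_ceil ((ξ * L) ^ 2); rw [hK]; push_cast; linarith
  -- pointwise bound
  have hpt : ∀ x, Real.exp (ξ * ‖powTwoExpSum L x‖) ≤
      2 * (∑ j ∈ Finset.range K, (ξ * ‖powTwoExpSum L x‖) ^ (2 * j) / (Nat.factorial (2 * j))) + 8 / 3 := by
    intro x
    set y := ξ * ‖powTwoExpSum L x‖ with hy
    have hy0 : 0 ≤ y := mul_nonneg hξ (norm_nonneg _)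
    have hyY : y ^ 2 ≤ K := by
      have : y ≤ ξ * L := mul_le_mul_of_nonneg_left (norm_powTwoExpSum_le L x) hξ
      exact (pow_le_pow_left₀ hy0 this 2).trans hYK
    have hcosh : Real.exp y ≤ 2 * Real.cosh y := by
      rw [Real.cosh_eq]; have := Real.exp_pos (-y); linarith
    have := cosh_le_sum_add hyY
    linarith
  -- integrate
  have hcontG : Continuous fun x => ‖powTwoExpSum L x‖ := continuous_norm.comp (continuous_powTwoExpSum L)
  have hcontT : ∀ j : ℕ, Continuous fun x => (ξ * ‖powTwoExpSum L x‖) ^ (2 * j) / (Nat.factorial (2 * j) : ℝ) :=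
    fun j => ((continuous_const.mul hcontG).pow _).div_const _
  have hcontS : Continuous fun x => ∑ j ∈ Finset.range K,
      (ξ * ‖powTwoExpSum L x‖) ^ (2 * j) / (Nat.factorial (2 * j) : ℝ) :=
    continuous_finsetSum _ fun j _ => hcontT j
  have hcontP : Continuous fun x => 2 * (∑ j ∈ Finset.range K,
      (ξ * ‖powTwoExpSum L x‖) ^ (2 * j) / (Nat.factorial (2 * j) : ℝ)) + 8 / 3 :=
    (continuous_const.mul hcontS).add continuous_const
  have hstep1 : ∫ x in (0 : ℝ)..1, Real.exp (ξ * ‖powTwoExpSum L x‖) ≤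
      ∫ x in (0 : ℝ)..1, (2 * (∑ j ∈ Finset.range K,
          (ξ * ‖powTwoExpSum L x‖) ^ (2 * j) / (Nat.factorial (2 * j) : ℝ)) + 8 / 3) :=
    intervalIntegral.integral_mono_on zero_le_one
      ((Real.continuous_exp.comp (continuous_const.mul hcontG)).intervalIntegrable _ _)
      (hcontP.intervalIntegrable _ _) fun x _ => hpt x
  have hstep2 : ∫ x in (0 : ℝ)..1, (2 * (∑ j ∈ Finset.range K,
      (ξ * ‖powTwoExpSum L x‖) ^ (2 * j) / (Nat.factorial (2 * j) : ℝ)) + 8 / 3) =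
      2 * (∑ j ∈ Finset.range K, ξ ^ (2 * j) / (Nat.factorial (2 * j)) *
          ∫ x in (0 : ℝ)..1, ‖powTwoExpSum L x‖ ^ (2 * j)) + 8 / 3 := by
    have hi1 : IntervalIntegrable (fun x => 2 * ∑ j ∈ Finset.range K,
        (ξ * ‖powTwoExpSum L x‖) ^ (2 * j) / (Nat.factorial (2 * j) : ℝ)) volume 0 1 :=
      (continuous_const.mul hcontS).intervalIntegrable _ _
    have hi2 : IntervalIntegrable (fun _ : ℝ => (8 / 3 : ℝ)) volume 0 1 := continuous_const.intervalIntegrable _ _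
    have hi3 : ∀ j ∈ Finset.range K, IntervalIntegrable
        (fun x => (ξ * ‖powTwoExpSum L x‖) ^ (2 * j) / (Nat.factorial (2 * j) : ℝ)) volume 0 1 :=
      fun j _ => (hcontT j).intervalIntegrable _ _
    rw [intervalIntegral.integral_add hi1 hi2, intervalIntegral.integral_const_mul,
      intervalIntegral.integral_finsetSum hi3]
    have hsumeq : ∑ j ∈ Finset.range K, ∫ x in (0 : ℝ)..1,
        (ξ * ‖powTwoExpSum L x‖) ^ (2 * j) / (Nat.factorial (2 * j) : ℝ) =
        ∑ j ∈ Finset.range K, ξ ^ (2 * j) / (Nat.factorial (2 * j)) *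
          ∫ x in (0 : ℝ)..1, ‖powTwoExpSum L x‖ ^ (2 * j) := by
      refine Finset.sum_congr rfl fun j _ => ?_
      rw [← intervalIntegral.integral_const_mul]
      refine intervalIntegral.integral_congr fun x _ => ?_
      rw [mul_pow]; ring
    rw [hsumeq]
    simp
  have hstep3 : ∑ j ∈ Finset.range K, ξ ^ (2 * j) / (Nat.factorial (2 * j)) *
      ∫ x in (0 : ℝ)..1, ‖powTwoExpSum L x‖ ^ (2 * j) ≤
      2 * K * ∑ j ∈ Finset.range K, ξ ^ (2 * j) / (Nat.factorial (2 * j)) *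
          ∫ x in (0 : ℝ)..1, cosSum L x ^ (2 * j) := by
    rw [Finset.mul_sum]
    refine Finset.sum_le_sum fun j hj => ?_
    have hS0 := integral_cosSum_pow_nonneg L (2 * j)
    have hc0 : 0 ≤ ξ ^ (2 * j) / (Nat.factorial (2 * j) : ℝ) := by positivity
    have hjK : (2 * j + 1 : ℝ) ≤ 2 * K := by
      have := Finset.mem_range.mp hj
      have : (j : ℝ) + 1 ≤ K := by exact_mod_cast this
      linarith
    calc ξ ^ (2 * j) / (Nat.factorial (2 * j)) * ∫ x in (0 : ℝ)..1, ‖powTwoExpSum L x‖ ^ (2 * j)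
        ≤ ξ ^ (2 * j) / (Nat.factorial (2 * j)) * ((2 * j + 1) * ∫ x in (0 : ℝ)..1, cosSum L x ^ (2 * j)) :=
          mul_le_mul_of_nonneg_left (integral_norm_pow_le L j) hc0
      _ ≤ ξ ^ (2 * j) / (Nat.factorial (2 * j)) * ((2 * K) * ∫ x in (0 : ℝ)..1, cosSum L x ^ (2 * j)) :=
          mul_le_mul_of_nonneg_left (mul_le_mul_of_nonneg_right hjK hS0) hc0
      _ = 2 * K * (ξ ^ (2 * j) / (Nat.factorial (2 * j)) * ∫ x in (0 : ℝ)..1, cosSum L x ^ (2 * j)) := by ring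
  have hstep4 := sum_even_integral_cosSum_pow_le_expMoment hξ L K
  have hK0 : (0 : ℝ) ≤ K := Nat.cast_nonneg K
  have h2K0 : (0 : ℝ) ≤ 2 * K := by positivity
  have hstep5 : 2 * (K : ℝ) * ∑ j ∈ Finset.range K, ξ ^ (2 * j) / (Nat.factorial (2 * j)) *
      ∫ x in (0 : ℝ)..1, cosSum L x ^ (2 * j) ≤ 2 * K * expMoment ξ L :=
    mul_le_mul_of_nonneg_left hstep4 h2K0
  have hfin : ∑ j ∈ Finset.range K, ξ ^ (2 * j) / (Nat.factorial (2 * j)) *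
      ∫ x in (0 : ℝ)..1, ‖powTwoExpSum L x‖ ^ (2 * j) ≤ 2 * K * expMoment ξ L := hstep3.trans hstep5
  calc ∫ x in (0 : ℝ)..1, Real.exp (ξ * ‖powTwoExpSum L x‖)
      ≤ 2 * (∑ j ∈ Finset.range K, ξ ^ (2 * j) / (Nat.factorial (2 * j)) *
          ∫ x in (0 : ℝ)..1, ‖powTwoExpSum L x‖ ^ (2 * j)) + 8 / 3 := hstep1.trans_eq hstep2
    _ ≤ 2 * (2 * K * expMoment ξ L) + 8 / 3 := by gcongr
    _ = 4 * K * expMoment ξ L + 8 / 3 := by ring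

/-- **Large deviations of `|G_L|`**: for `ξ ≥ 0` and real `t`,
`|{x ∈ [0,1] : |G_L(x)| ≥ t}| ≤ e^{-ξt} (4K E_L(ξ) + 8/3)`, `K = ⌈(ξL)²⌉ + 1` (Markov for `e^{ξ|G_L|}`
and `integral_exp_norm_powTwoExpSum_le`); with `expMoment_le_pow_mul_exp` (Theorem 2(b)) the right side
is `e^{-ξt} (4K E*_M(ξ)^{⌊L/M⌋} e^{ξ(L mod M)} + 8/3)` — the shape of Corollaries 1–2 (the set
`𝓔 = {|G_L| > (1-η)L}`). [cite: PintzRuzsa2003, §7 Corollaries 1–2 (scheme)] -/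
theorem measureReal_norm_powTwoExpSum_ge_le {ξ : ℝ} (hξ : 0 ≤ ξ) (L : ℕ) (t : ℝ) :
    volume.real {x ∈ Set.Icc (0 : ℝ) 1 | t ≤ ‖powTwoExpSum L x‖} ≤
      Real.exp (-(ξ * t)) * (4 * ((⌈(ξ * L) ^ 2⌉₊ + 1 : ℕ) : ℝ) * expMoment ξ L + 8 / 3) := by
  set μ : Measure ℝ := volume.restrict (Set.Icc (0 : ℝ) 1) with hμ
  haveI : IsFiniteMeasure μ := by rw [hμ]; infer_instance
  have hcontG : Continuous fun x => ‖powTwoExpSum L x‖ := continuous_norm.comp (continuous_powTwoExpSum L)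
  set f : ℝ → ℝ := fun x => Real.exp (ξ * ‖powTwoExpSum L x‖) with hf
  have hfcont : Continuous f := Real.continuous_exp.comp (continuous_const.mul hcontG)
  have hf0 : 0 ≤ᵐ[μ] f := Eventually.of_forall fun x => (Real.exp_pos _).le
  have hfint : Integrable f μ := by
    rw [hμ]; exact hfcont.continuousOn.integrableOn_compact isCompact_Icc
  have hmarkov := mul_meas_ge_le_integral_of_nonneg hf0 hfint (Real.exp (ξ * t))
  have hint : ∫ x, f x ∂μ = ∫ x in (0 : ℝ)..1, Real.exp (ξ * ‖powTwoExpSum L x‖) := by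
    rw [hμ, intervalIntegral.integral_of_le zero_le_one, integral_Icc_eq_integral_Ioc]
  rw [hint] at hmarkov
  have hI := integral_exp_norm_powTwoExpSum_le hξ L
  have hmeas : MeasurableSet {x : ℝ | t ≤ ‖powTwoExpSum L x‖} :=
    (isClosed_le continuous_const hcontG).measurableSet
  have hsub : {x : ℝ | t ≤ ‖powTwoExpSum L x‖} ⊆ {x | Real.exp (ξ * t) ≤ f x} := fun x hx =>
    Real.exp_le_exp.mpr (mul_le_mul_of_nonneg_left hx hξ)
  have hset : volume.real {x ∈ Set.Icc (0 : ℝ) 1 | t ≤ ‖powTwoExpSum L x‖} =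
      μ.real {x : ℝ | t ≤ ‖powTwoExpSum L x‖} := by
    rw [hμ, measureReal_restrict_apply hmeas]
    congr 1
    ext x
    simp [and_comm]
  rw [hset]
  have hexp : 0 < Real.exp (ξ * t) := Real.exp_pos _
  calc μ.real {x : ℝ | t ≤ ‖powTwoExpSum L x‖} ≤ μ.real {x | Real.exp (ξ * t) ≤ f x} := measureReal_mono hsub
    _ ≤ (∫ x in (0 : ℝ)..1, Real.exp (ξ * ‖powTwoExpSum L x‖)) / Real.exp (ξ * t) := by
        rw [le_div_iff₀ hexp, mul_comm]; exact hmarkov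
    _ ≤ (4 * ((⌈(ξ * L) ^ 2⌉₊ + 1 : ℕ) : ℝ) * expMoment ξ L + 8 / 3) / Real.exp (ξ * t) :=
        div_le_div_of_nonneg_right hI hexp.le
    _ = Real.exp (-(ξ * t)) * (4 * ((⌈(ξ * L) ^ 2⌉₊ + 1 : ℕ) : ℝ) * expMoment ξ L + 8 / 3) := by
        rw [Real.exp_neg, div_eq_inv_mul]

/-! ### Pintz–Ruzsa's `G(α) = ∑_{m=1}^{L} e(2^m α) = G_L(2α)` and the set `𝓔` -/

/-- `e(n) = 1` for `n ∈ ℕ`. [folklore] -/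
theorem fourierChar_natCast_coe (n : ℕ) : (𝐞 (n : ℝ) : ℂ) = 1 := by
  rw [Real.fourierChar_apply]
  have : ((2 * π * (n : ℝ) : ℝ) : ℂ) * Complex.I = n * (2 * π * Complex.I) := by push_cast; ring
  rw [this, Complex.exp_nat_mul_two_pi_mul_I]

/-- `G_L` has period `1`. [folklore] -/
theorem powTwoExpSum_add_one (L : ℕ) (x : ℝ) : powTwoExpSum L (x + 1) = powTwoExpSum L x := by
  unfold powTwoExpSum
  refine Finset.sum_congr rfl fun j _ => ?_
  rw [mul_add, mul_one, fourierChar_add_coe, fourierChar_natCast_coe, mul_one]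

/-- **`G(α) = G_L(2α)`**: the tree's `GoldbachLinnik.powSum N α = ∑_{m=1}^{L} e(2^m α)` (`L = [log₂ N]`,
Pintz–Ruzsa (8.4)) is `G_L` at `2α`. [cite: PintzRuzsa2003, §8 (8.4) and §4] -/
theorem powSum_eq_powTwoExpSum (N : ℕ) (α : ℝ) : powSum N α = powTwoExpSum (powLen N) (2 * α) := by
  unfold powSum powTwoExpSum
  rw [← Finset.Ico_add_one_right_eq_Icc, Finset.sum_Ico_eq_sum_range, Nat.add_sub_cancel]
  refine Finset.sum_congr rfl fun j _ => ?_
  congr 2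
  rw [Nat.add_comm 1 j, pow_succ]
  push_cast
  ring

/-- Doubling the variable does not change the measure of a `1`-periodic superlevel set on `[0,1]`:
`|{α ∈ [0,1] : t ≤ |G_L(2α)|}| ≤ |{x ∈ [0,1] : t ≤ |G_L(x)|}|` (the two halves of `[0,1]` map onto
`[0,1]` and `[1,2] = [0,1] + 1`). [folklore] -/
theorem measureReal_norm_powTwoExpSum_two_mul_ge_le (L : ℕ) (t : ℝ) :
    volume.real {α ∈ Set.Icc (0 : ℝ) 1 | t ≤ ‖powTwoExpSum L (2 * α)‖} ≤
      volume.real {x ∈ Set.Icc (0 : ℝ) 1 | t ≤ ‖powTwoExpSum L x‖} := by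
  set B : Set ℝ := {x ∈ Set.Icc (0 : ℝ) 1 | t ≤ ‖powTwoExpSum L x‖} with hB
  -- the two halves
  set A₁ : Set ℝ := (fun α : ℝ => 2 * α) ⁻¹' B with hA₁
  set A₂ : Set ℝ := (fun α : ℝ => 2 * α) ⁻¹' ((fun y : ℝ => y + (-1)) ⁻¹' B) with hA₂
  have hsub : {α ∈ Set.Icc (0 : ℝ) 1 | t ≤ ‖powTwoExpSum L (2 * α)‖} ⊆ A₁ ∪ A₂ := by
    intro α hα
    obtain ⟨⟨h0, h1⟩, ht⟩ := hα
    rcases le_or_gt α (1 / 2) with hle | hgt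
    · left
      simp only [hA₁, hB, Set.mem_preimage, Set.mem_setOf_eq, Set.mem_Icc]
      exact ⟨⟨by linarith, by linarith⟩, ht⟩
    · right
      simp only [hA₂, hB, Set.mem_preimage, Set.mem_setOf_eq, Set.mem_Icc]
      refine ⟨⟨by linarith, by linarith⟩, ?_⟩
      have : powTwoExpSum L (2 * α + -1) = powTwoExpSum L (2 * α) := by
        rw [← powTwoExpSum_add_one L (2 * α + -1)]; ring_nf
      rw [this]; exact ht
  have hBfin : volume B ≠ ⊤ := by
    refine ne_top_of_le_ne_top ?_ (measure_mono (fun x hx => hx.1 : B ⊆ Set.Icc (0 : ℝ) 1))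
    rw [Real.volume_Icc]
    exact ENNReal.ofReal_ne_top
  have h2 : (2 : ℝ) ≠ 0 := two_ne_zero
  have hA₁vol : volume A₁ = ENNReal.ofReal (1 / 2) * volume B := by
    rw [hA₁, Real.volume_preimage_mul_left h2]; norm_num
  have hA₂vol : volume A₂ = ENNReal.ofReal (1 / 2) * volume B := by
    rw [hA₂, Real.volume_preimage_mul_left h2, measure_preimage_add_right]; norm_num
  have hhalf : ENNReal.ofReal (1 / 2) * volume B ≠ ⊤ := ENNReal.mul_ne_top ENNReal.ofReal_ne_top hBfin
  calc volume.real {α ∈ Set.Icc (0 : ℝ) 1 | t ≤ ‖powTwoExpSum L (2 * α)‖}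
      ≤ volume.real (A₁ ∪ A₂) := measureReal_mono hsub (by
          refine ne_top_of_le_ne_top ?_ (measure_union_le A₁ A₂)
          rw [hA₁vol, hA₂vol]; exact ENNReal.add_ne_top.mpr ⟨hhalf, hhalf⟩)
    _ ≤ volume.real A₁ + volume.real A₂ := measureReal_union_le _ _
    _ = volume.real B := by
        simp only [measureReal_def, hA₁vol, hA₂vol]
        rw [← ENNReal.toReal_add hhalf hhalf, ← two_mul, ← mul_assoc]
        congr 1
        rw [show (2 : ENNReal) * ENNReal.ofReal (1 / 2) = 1 by
          rw [← ENNReal.ofReal_ofNat 2, ← ENNReal.ofReal_mul (by norm_num)]; norm_num, one_mul]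

/-- **Large deviations of `|G(α)|` for the tree's `G = GoldbachLinnik.powSum`**: for `ξ ≥ 0` and
real `t`, with `L = [log₂ N]` and `K = ⌈(ξL)²⌉ + 1`,
`|{α ∈ [0,1] : |G(α)| ≥ t}| ≤ e^{-ξt} (4K E_L(ξ) + 8/3)`; combine with `expMoment_le_pow_mul_exp` and ONE
numerical bound for `E*_M(ξ)` to obtain `|𝓔| = |{|G| > λL}| ≪ N^{-c}` (Corollary 2: `λ = 0.7894…`,
`c = 3/5`; the numerics are not in the tree). [cite: PintzRuzsa2003, §7 Corollary 2 (scheme)] -/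
theorem measureReal_norm_powSum_ge_le {ξ : ℝ} (hξ : 0 ≤ ξ) (N : ℕ) (t : ℝ) :
    volume.real {α ∈ Set.Icc (0 : ℝ) 1 | t ≤ ‖powSum N α‖} ≤
      Real.exp (-(ξ * t)) * (4 * ((⌈(ξ * powLen N) ^ 2⌉₊ + 1 : ℕ) : ℝ) * expMoment ξ (powLen N) + 8 / 3) := by
  have hset : {α ∈ Set.Icc (0 : ℝ) 1 | t ≤ ‖powSum N α‖} =
      {α ∈ Set.Icc (0 : ℝ) 1 | t ≤ ‖powTwoExpSum (powLen N) (2 * α)‖} := by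
    ext α; simp [powSum_eq_powTwoExpSum]
  rw [hset]
  exact (measureReal_norm_powTwoExpSum_two_mul_ge_le _ _).trans (measureReal_norm_powTwoExpSum_ge_le hξ _ _)

/-- **Corollary 2 modulo one number.** If for some `ξ ≥ 0` and `M ≥ 1` the finite sum
`E*_M(ξ) = 2^{-M} ∑_{k<2^M} e^{ξ S_M(k 2^{-M})}` is bounded by `B ≥ 1`, then for every `N` (`L = [log₂ N]`)
and every `t`,
`|{α ∈ [0,1] : |G(α)| ≥ t}| ≤ e^{-ξt} (4K e^{ξM} e^{L (log B)/M} + 8/3)`, `K = ⌈(ξL)²⌉ + 1`;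
with `t = λL` the exponent is `-L(ξλ - (log B)/M)`, so any certified value `B` with `ξλ - (log B)/M > c log 2`
gives `|𝓔| = |{|G| ≥ λL}| ≪ L² N^{-c}` (Pintz–Ruzsa's Corollary 2: `λ = 0.7894…`, `c = 3/5`; their `B` comes
from the refined computation of §§5–6, not from `E*_M` directly). [cite: PintzRuzsa2003, §7 (7.1) and Corollary 2] -/
theorem measureReal_norm_powSum_ge_le_of_discMoment_le {ξ : ℝ} (hξ : 0 ≤ ξ) {M : ℕ} (hM : 0 < M)
    {B : ℝ} (hB1 : 1 ≤ B) (hB : discMoment ξ M ≤ B) (N : ℕ) (t : ℝ) :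
    volume.real {α ∈ Set.Icc (0 : ℝ) 1 | t ≤ ‖powSum N α‖} ≤
      Real.exp (-(ξ * t)) * (4 * ((⌈(ξ * powLen N) ^ 2⌉₊ + 1 : ℕ) : ℝ) *
        (Real.exp (ξ * M) * Real.exp (powLen N * Real.log B / M)) + 8 / 3) := by
  set L := powLen N with hL
  have hD0 : 0 ≤ discMoment ξ M := discMoment_nonneg ξ M
  have hB0 : 0 < B := by linarith
  have hlogB : 0 ≤ Real.log B := Real.log_nonneg hB1
  -- `E_L ≤ D^{⌊L/M⌋} e^{ξ(L mod M)} ≤ B^{⌊L/M⌋} e^{ξM} ≤ e^{L log B / M} e^{ξM}`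
  have hE : expMoment ξ L ≤ Real.exp (ξ * M) * Real.exp (L * Real.log B / M) := by
    have h1 := expMoment_le_pow_mul_exp hξ M L
    have h2 : discMoment ξ M ^ (L / M) ≤ B ^ (L / M) := pow_le_pow_left₀ hD0 hB _
    have h3 : Real.exp (ξ * (L % M : ℕ)) ≤ Real.exp (ξ * M) := by
      refine Real.exp_le_exp.mpr (mul_le_mul_of_nonneg_left ?_ hξ)
      exact_mod_cast (Nat.mod_lt L hM).le
    have h4 : B ^ (L / M) ≤ Real.exp (L * Real.log B / M) := by
      rw [← Real.rpow_natCast, Real.rpow_def_of_pos hB0]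
      refine Real.exp_le_exp.mpr ?_
      have : ((L / M : ℕ) : ℝ) ≤ (L : ℝ) / M := Nat.cast_div_le
      calc Real.log B * ((L / M : ℕ) : ℝ) ≤ Real.log B * ((L : ℝ) / M) := mul_le_mul_of_nonneg_left this hlogB
        _ = L * Real.log B / M := by ring
    calc expMoment ξ L ≤ discMoment ξ M ^ (L / M) * Real.exp (ξ * (L % M : ℕ)) := h1
      _ ≤ B ^ (L / M) * Real.exp (ξ * M) :=
          mul_le_mul h2 h3 (Real.exp_pos _).le (pow_nonneg hB0.le _)
      _ ≤ Real.exp (L * Real.log B / M) * Real.exp (ξ * M) :=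
          mul_le_mul_of_nonneg_right h4 (Real.exp_pos _).le
      _ = Real.exp (ξ * M) * Real.exp (L * Real.log B / M) := mul_comm _ _
  refine (measureReal_norm_powSum_ge_le hξ N t).trans ?_
  refine mul_le_mul_of_nonneg_left ?_ (Real.exp_pos _).le
  have hK0 : (0 : ℝ) ≤ 4 * ((⌈(ξ * L) ^ 2⌉₊ + 1 : ℕ) : ℝ) := by positivity
  nlinarith [mul_le_mul_of_nonneg_left hE hK0]

end PintzRuzsa2003

end Literature.NumberTheory.Sieve

end
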